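import Summits.ValiantsHypothesis.ValiantsHypothesis.Theorems.KPlusLogSqLawTropicalBMasterLawConverse
import Summits.ValiantsHypothesis.ValiantsHypothesis.Theorems.KPlusLogSqLawTropicalBSplitDefs

/-!
# Route `KPlusLogSqLaw`, crux `TropicalB` (stmt-ValiantsHypothesis-19771) — CONVERSE OF THE MASTER LAW, part 2:
# THE REALISABILITY DUAL IS COMPLETE — a term sequence is a dominant chain of SOME design iff it carries no certificate

HONEST FRAMING.  Helper file (seat val-sym-trop-p1 g26, cell `pub-symmetroid`, 2026-08-29; `--supports stmt-ValiantsHypothesis-19771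
--as helper`) toward the registered stubs `stub_tropThin` / `stub_tropFat` of `Cruxes/TropicalB/Lines/birth.lean` (crux
`Summit.ValiantsHypothesis.ValiantsHypothesis.Theses.KPlusLogSqLaw.TropicalB`, route `KPlusLogSqLaw`).  An exact criterion and a kernel iff for the
unsigned row; route-independent imports only; nothing here bounds anything: `TropicalB` / both stubs stay OPEN, the residual of record («long carries», g25) is untouched; nothing on
`WeakLifting`, the cell's census / DoorA26 / DoorA34, `MatrixDescartes` (stmt-ValiantsHypothesis-18050) or VP ≠ VNP.

CONTENTS (part 1 = `…TropicalBMasterLawConverse`: no certificate ⇒ a RATIONAL solution of the realisability system).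
* `exists_design_of_no_certificate` — **COMPLETENESS**: no certificate ⇒ integer valuations `v`, the `{0,1}` incidence pattern `ε` := «union
  of the chain's incidences», and integer slopes `θ 0 < ⋯ < θ n` with every `p k` the unique optimum (`IsDominant d v ε (θ k) (p k)`).
  From part 1 by clearing denominators (`exists_nat_mul_integral`); a present competitor of this design has all its incidences in the union
  of the chain's incidences (`termSign ≠ 0` reads off the `{0,1}` pattern), so it is one of the competitors of the system.
* `no_certificate_of_design` — SOUNDNESS for chain-supported competitors (present as soon as the chain is), via the tree's `master_law`
  (this lineage g11); the total slope excess vanishes by balance on the exponent table (`HingeLaw.slope_eq_ev`), so it is no hypothesis.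
* `exists_design_iff_canonicalSupport` — NORMAL FORM: realised by some design ⟺ realised on the canonical support (unsigned, every
  present incidence used by the chain).
* `exists_design_iff_no_certificate` — **THE REALISABILITY CRITERION**: for ANY `d` and ANY terms `p 0, …, p n`, (∃ design and slopes
  realising them as unique optima) ⟺ (the only non-negative rational multiplier system on pairs (`k ≤ n`, chain-supported `q ≠ p k`) that
  is incidence-balanced with non-negative proper prefix slope excesses is `0`).
* `tropRowD_iff_certificateFree` — `TropRowD m K B` ⟺ every certificate-free term sequence with consecutive terms distinct has `n ≤ B`.
* (part 3, `…TropicalBMasterLawCruxForm`, the only file of the three in the route's import cone: **`TropicalB` ⟺ ∃ C, ∀ m K d, every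
  certificate-free term sequence of format `(m, K)` with consecutive terms distinct has `n ≤ 2^(C (K + ⌊log₂ m⌋²))`**.)
READING.  The design, its valuations and the sampling slopes are ELIMINATED from the crux; what is left is the exponent vector (through the
slopes `S q = Σ_b d (q.2 b)`) and the finite combinatorics of weighted repackagings of incidences.  The family of exchange laws with RATIONAL
multipliers (two-body / multi-exchange / Latin / lex-core laws are members) is COMPLETE — there is no realisability law beyond certificates —
and a located «LP-infeasible» verdict on a candidate family is, exactly, the existence of one finite multiplier system, checkable by the kernel
when exhibited.  [folklore: LP duality / theorems of the alternative; packaging this cell]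
-/

set_option linter.dupNamespace false
set_option autoImplicit false

namespace Summit.ValiantsHypothesis.ValiantsHypothesis.Theorems.KPlusLogSqLaw.MasterLaw

open Summit.ValiantsHypothesis.ValiantsHypothesis.Theorems.MatrixDescartes.Negative
open Summit.ValiantsHypothesis.ValiantsHypothesis.Theorems.KPlusLogSqLaw.ConvexPosition
open Summit.ValiantsHypothesis.ValiantsHypothesis.Theorems.LacunarySymmetroidMatrixDescartes.TropicalCensus (slope)
open scoped BigOperators
open Finset

variable {m K : ℕ}

/-! ## 2'. Completeness: no certificate ⇒ a design exists -/

/-- **COMPLETENESS OF THE REALISABILITY DUAL.**  If the only certificate against the term sequence `p 0, …, p n` (exponents `d`) is the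
zero multiplier system, then the sequence IS REALISED, on the CANONICAL SUPPORT: integer valuations `v` and integer slopes
`θ 0 < ⋯ < θ n` make every `p k` the unique optimum at `θ k` of the design `(d, v, ε₀)` whose incidence pattern `ε₀ ∈ {0,1}` is the
indicator of the union of the chain's incidences.  Converse of `master_law`. [folklore: LP duality; packaging this cell] -/
theorem exists_design_of_no_certificate (d : Fin K → ℕ) (n : ℕ) (p : ℕ → Equiv.Perm (Fin m) × (Fin m → Fin K))
    (hfree : ∀ lam : ℕ → (Equiv.Perm (Fin m) × (Fin m → Fin K)) → ℚ, (∀ k q, 0 ≤ lam k q) →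
      (∀ k q, lam k q ≠ 0 → k ≤ n ∧ q ≠ p k ∧ ∀ b, ∃ k' ≤ n, (p k').1 b = q.1 b ∧ (p k').2 b = q.2 b) →
      (∀ F : Fin m × Fin m × Fin K → ℤ, ∑ k ∈ range (n + 1), ∑ q, lam k q * ((ev F (p k) : ℚ) - (ev F q : ℚ)) = 0) →
      (∀ k < n, 0 ≤ ∑ k' ∈ range (k + 1), ∑ q, lam k' q * ((slope d (p k') : ℚ) - (slope d q : ℚ))) →
      ∀ k q, lam k q = 0) :
    ∃ (v : Fin m → Fin m → Fin K → ℤ) (θ : ℕ → ℤ), (∀ k < n, θ k < θ (k + 1)) ∧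
      ∀ k ≤ n, IsDominant d v (fun a b l => if ∃ k' ≤ n, (p k').1 b = a ∧ (p k').2 b = l then 1 else 0) (θ k) (p k) := by
  classical
  obtain ⟨w, t, ht, hw⟩ := exists_rational_solution_of_no_certificate d n p hfree
  -- clear denominators of the finitely many rationals that matter
  obtain ⟨N, hNpos, hN⟩ := exists_nat_mul_integral
    (Sum.elim w (fun k : Fin (n + 1) => t k) : (Fin m × Fin m × Fin K) ⊕ Fin (n + 1) → ℚ)
  choose z hz using hN
  have hNq : (0 : ℚ) < (N : ℚ) := by exact_mod_cast hNpos
  have hzw : ∀ c, (N : ℚ) * w c = z (Sum.inl c) := fun c => hz (Sum.inl c)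
  have hzt : ∀ k : Fin (n + 1), (N : ℚ) * t k = z (Sum.inr k) := fun k => hz (Sum.inr k)
  -- the design
  let ε : Fin m → Fin m → Fin K → ℤ := fun a b l => if ∃ k ≤ n, (p k).1 b = a ∧ (p k).2 b = l then 1 else 0
  let v : Fin m → Fin m → Fin K → ℤ := fun a b l => z (Sum.inl (a, b, l))
  let θ : ℕ → ℤ := fun i => if h : i < n + 1 then z (Sum.inr ⟨i, h⟩) else 0
  refine ⟨v, θ, fun k hk => ?_, fun k hk => ?_⟩
  · -- strictly increasing slopes
    have h' : (N : ℚ) * t k < (N : ℚ) * t (k + 1) := mul_lt_mul_of_pos_left (ht k hk) hNq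
    have e1 := hzt ⟨k, by omega⟩
    have e2 := hzt ⟨k + 1, by omega⟩
    simp only at e1 e2
    rw [e1, e2] at h'
    have h'' : z (Sum.inr ⟨k, by omega⟩) < z (Sum.inr ⟨k + 1, by omega⟩) := by exact_mod_cast h'
    simp only [θ, dif_pos (show k < n + 1 by omega), dif_pos (show k + 1 < n + 1 by omega)]
    exact h''
  · -- dominance of `p k` at `θ k`
    change IsDominant d v ε (θ k) (p k)
    have hkFin : k < n + 1 := by omega
    have hpres_chain : ∀ b, ε ((p k).1 b) b ((p k).2 b) = 1 := by
      intro b; simp only [ε]; rw [if_pos ⟨k, hk, rfl, rfl⟩]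
    have hsign : termSign ε (p k) ≠ 0 := by
      unfold termSign
      rw [Finset.prod_eq_one fun b _ => hpres_chain b, mul_one]
      exact Units.ne_zero _
    refine ⟨hsign, fun q hne hq => ?_⟩
    -- a present competitor is chain-supported
    have hsupp : ∀ b, ∃ k' ≤ n, (p k').1 b = q.1 b ∧ (p k').2 b = q.2 b := by
      intro b
      by_contra hcon
      apply hq
      unfold termSign
      rw [Finset.prod_eq_zero (Finset.mem_univ b), mul_zero]
      simp only [ε]
      rw [if_neg]
      exact hcon
    have h := hw k hk q hne hsupp
    -- scale by `N` and read off integers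
    have hV : ∀ u : Equiv.Perm (Fin m) × (Fin m → Fin K),
        (N : ℚ) * ∑ b, w (u.1 b, b, u.2 b) = ((∑ b, v (u.1 b) b (u.2 b) : ℤ) : ℚ) := by
      intro u
      rw [Finset.mul_sum]
      push_cast
      exact Finset.sum_congr rfl fun b _ => hzw _
    have hΘ : (N : ℚ) * t k = ((θ k : ℤ) : ℚ) := by
      have e := hzt ⟨k, hkFin⟩
      simp only at e
      rw [e]; simp only [θ, dif_pos hkFin]
    have h' : (N : ℚ) * (t k * (slope d q : ℚ) - ∑ b, w (q.1 b, b, q.2 b)) <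
        (N : ℚ) * (t k * (slope d (p k) : ℚ) - ∑ b, w ((p k).1 b, b, (p k).2 b)) := mul_lt_mul_of_pos_left h hNq
    have h'' : ((θ k : ℤ) : ℚ) * (slope d q : ℚ) - ((∑ b, v (q.1 b) b (q.2 b) : ℤ) : ℚ) <
        ((θ k : ℤ) : ℚ) * (slope d (p k) : ℚ) - ((∑ b, v ((p k).1 b) b ((p k).2 b) : ℤ) : ℚ) := by
      rw [← hV, ← hV, ← hΘ]
      have e1 : (N : ℚ) * (t k * (slope d q : ℚ) - ∑ b, w (q.1 b, b, q.2 b)) =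
          (N : ℚ) * t k * (slope d q : ℚ) - (N : ℚ) * ∑ b, w (q.1 b, b, q.2 b) := by ring
      have e2 : (N : ℚ) * (t k * (slope d (p k) : ℚ) - ∑ b, w ((p k).1 b, b, (p k).2 b)) =
          (N : ℚ) * t k * (slope d (p k) : ℚ) - (N : ℚ) * ∑ b, w ((p k).1 b, b, (p k).2 b) := by ring
      rw [e1, e2] at h'
      exact h'
    have hint : θ k * slope d q - (∑ b, v (q.1 b) b (q.2 b)) < θ k * slope d (p k) - (∑ b, v ((p k).1 b) b ((p k).2 b)) := by
      exact_mod_cast h''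
    rw [HingeLaw.tropWeight_eq, HingeLaw.tropWeight_eq]
    exact hint

/-! ## 3. Soundness (the tree's `master_law`, restated for chain-supported competitors) and the equivalence -/

/-- **SOUNDNESS** (= `master_law` for competitors built from the chain's own incidences): if `p 0, …, p n` ARE the unique optima
of some design at increasing integer slopes, every certificate vanishes.  A competitor all of whose incidences are incidences of
chain terms is present as soon as the chain terms are, so `master_law` applies. [folklore: LP duality, easy direction; this cell] -/
theorem no_certificate_of_design (d : Fin K → ℕ) (n : ℕ) (p : ℕ → Equiv.Perm (Fin m) × (Fin m → Fin K))
    (v ε : Fin m → Fin m → Fin K → ℤ) (θ : ℕ → ℤ) (hθ : ∀ k < n, θ k < θ (k + 1))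
    (hdom : ∀ k ≤ n, IsDominant d v ε (θ k) (p k))
    (lam : ℕ → (Equiv.Perm (Fin m) × (Fin m → Fin K)) → ℚ) (hlam : ∀ k q, 0 ≤ lam k q)
    (hsupp : ∀ k q, lam k q ≠ 0 → k ≤ n ∧ q ≠ p k ∧ ∀ b, ∃ k' ≤ n, (p k').1 b = q.1 b ∧ (p k').2 b = q.2 b)
    (hbal : ∀ F : Fin m × Fin m × Fin K → ℤ, ∑ k ∈ range (n + 1), ∑ q, lam k q * ((ev F (p k) : ℚ) - (ev F q : ℚ)) = 0)
    (hpre : ∀ k < n, 0 ≤ ∑ k' ∈ range (k + 1), ∑ q, lam k' q * ((slope d (p k') : ℚ) - (slope d q : ℚ))) :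
    ∀ k q, lam k q = 0 := by
  -- chain-supported competitors are present
  have hpres : ∀ k ≤ n, ∀ q, lam k q ≠ 0 → termSign ε q ≠ 0 ∧ q ≠ p k := by
    intro k _ q h
    obtain ⟨-, hne, hs⟩ := hsupp k q h
    refine ⟨?_, hne⟩
    unfold termSign
    refine mul_ne_zero (Units.ne_zero _) (Finset.prod_ne_zero_iff.mpr fun b _ => ?_)
    obtain ⟨k', hk', h1, h2⟩ := hs b
    have hk'pres := (hdom k' hk').1
    unfold termSign at hk'pres
    have := (Finset.prod_ne_zero_iff.mp (right_ne_zero_of_mul hk'pres)) b (Finset.mem_univ b)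
    rwa [h1, h2] at this
  -- the total slope excess vanishes by balance applied to the exponent table
  have htot : ∑ k ∈ range (n + 1), ∑ q, lam k q * ((slope d (p k) : ℚ) - (slope d q : ℚ)) = 0 := by
    have h := hbal (fun c => (d c.2.2 : ℤ))
    simpa only [HingeLaw.slope_eq_ev] using h
  intro k q
  by_cases hk : k ≤ n
  · exact master_law d v ε n θ p hdom hθ lam hlam hpres hbal hpre htot k hk q
  · by_contra h
    exact hk (hsupp k q h).1

/-- **THE REALISABILITY CRITERION (kernel iff).**  For ANY exponents `d` and ANY terms `p 0, …, p n` of format `(m, K)`: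
there is a design `(d, v, ε)` (`|ε| ≤ 1`) and integer slopes `θ 0 < ⋯ < θ n` making every `p k` the unique optimum at `θ k`
IF AND ONLY IF the only non-negative rational multiplier system `lam k q` on pairs (`k ≤ n`, `q ≠ p k` a term built from incidences of
the chain) that is incidence-balanced and has all proper prefix slope excesses `≥ 0` is `lam = 0`.  So the realisability of a candidate
chain — the cell's LP oracle — is a statement of pure finite combinatorics about weighted repackagings of the chain's incidences.
[folklore: LP duality (Carver / Motzkin transposition); packaging this cell] -/
theorem exists_design_iff_no_certificate (d : Fin K → ℕ) (n : ℕ) (p : ℕ → Equiv.Perm (Fin m) × (Fin m → Fin K)) :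
    (∃ (v ε : Fin m → Fin m → Fin K → ℤ) (θ : ℕ → ℤ), (∀ i j l, (ε i j l).natAbs ≤ 1) ∧
      (∀ k < n, θ k < θ (k + 1)) ∧ ∀ k ≤ n, IsDominant d v ε (θ k) (p k)) ↔
    (∀ lam : ℕ → (Equiv.Perm (Fin m) × (Fin m → Fin K)) → ℚ, (∀ k q, 0 ≤ lam k q) →
      (∀ k q, lam k q ≠ 0 → k ≤ n ∧ q ≠ p k ∧ ∀ b, ∃ k' ≤ n, (p k').1 b = q.1 b ∧ (p k').2 b = q.2 b) →
      (∀ F : Fin m × Fin m × Fin K → ℤ, ∑ k ∈ range (n + 1), ∑ q, lam k q * ((ev F (p k) : ℚ) - (ev F q : ℚ)) = 0) →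
      (∀ k < n, 0 ≤ ∑ k' ∈ range (k + 1), ∑ q, lam k' q * ((slope d (p k') : ℚ) - (slope d q : ℚ))) →
      ∀ k q, lam k q = 0) := by
  constructor
  · rintro ⟨v, ε, θ, -, hθ, hdom⟩ lam hlam hsupp hbal hpre
    exact no_certificate_of_design d n p v ε θ hθ hdom lam hlam hsupp hbal hpre
  · intro hfree
    obtain ⟨v, θ, hθ, hdom⟩ := exists_design_of_no_certificate d n p hfree
    refine ⟨v, _, θ, fun a b l => ?_, hθ, hdom⟩
    split_ifs <;> simp

/-- **CANONICAL SUPPORT (normal form).**  A term sequence realised by SOME design `(d, v, ε)` (any sign / presence pattern with `|ε| ≤ 1`)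
is realised by a design on the canonical support: `{0,1}`-valued `ε₀` = the indicator of the union of the chain's incidences (every
present incidence is used by the chain, no signs).  Round trip through the criterion. [this cell] -/
theorem exists_design_iff_canonicalSupport (d : Fin K → ℕ) (n : ℕ) (p : ℕ → Equiv.Perm (Fin m) × (Fin m → Fin K)) :
    (∃ (v ε : Fin m → Fin m → Fin K → ℤ) (θ : ℕ → ℤ), (∀ i j l, (ε i j l).natAbs ≤ 1) ∧
      (∀ k < n, θ k < θ (k + 1)) ∧ ∀ k ≤ n, IsDominant d v ε (θ k) (p k)) ↔
    (∃ (v : Fin m → Fin m → Fin K → ℤ) (θ : ℕ → ℤ), (∀ k < n, θ k < θ (k + 1)) ∧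
      ∀ k ≤ n, IsDominant d v (fun a b l => if ∃ k' ≤ n, (p k').1 b = a ∧ (p k').2 b = l then 1 else 0) (θ k) (p k)) := by
  constructor
  · rintro ⟨v, ε, θ, -, hθ, hdom⟩
    exact exists_design_of_no_certificate d n p
      (fun lam hlam hsupp hbal hpre => no_certificate_of_design d n p v ε θ hθ hdom lam hlam hsupp hbal hpre)
  · rintro ⟨v, θ, hθ, hdom⟩
    refine ⟨v, _, θ, fun a b l => ?_, hθ, hdom⟩
    split_ifs <;> simp

/-! ## 4. The crux without valuations or slopes -/

/-- **The unsigned tropical row as a statement about certificate-free term sequences.**  `TropRowD m K B` holds iff every sequence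
`p 0, …, p n` of terms of format `(m, K)` with consecutive terms distinct that admits NO certificate (for some exponent vector `d`) has
`n ≤ B`. [this cell] -/
theorem tropRowD_iff_certificateFree (m K B : ℕ) :
    TropRowD m K B ↔ ∀ (d : Fin K → ℕ) (n : ℕ) (p : ℕ → Equiv.Perm (Fin m) × (Fin m → Fin K)),
      (∀ k < n, p k ≠ p (k + 1)) →
      (∀ lam : ℕ → (Equiv.Perm (Fin m) × (Fin m → Fin K)) → ℚ, (∀ k q, 0 ≤ lam k q) →
        (∀ k q, lam k q ≠ 0 → k ≤ n ∧ q ≠ p k ∧ ∀ b, ∃ k' ≤ n, (p k').1 b = q.1 b ∧ (p k').2 b = q.2 b) →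
        (∀ F : Fin m × Fin m × Fin K → ℤ, ∑ k ∈ range (n + 1), ∑ q, lam k q * ((ev F (p k) : ℚ) - (ev F q : ℚ)) = 0) →
        (∀ k < n, 0 ≤ ∑ k' ∈ range (k + 1), ∑ q, lam k' q * ((slope d (p k') : ℚ) - (slope d q : ℚ))) →
        ∀ k q, lam k q = 0) →
      n ≤ B := by
  constructor
  · intro hT d n p hdist hfree
    obtain ⟨v, θ, hθ, hdom⟩ := exists_design_of_no_certificate d n p hfree
    refine hT d v _ n (fun k => θ k) (fun k => p k) ?_ (fun k => hdom k (Nat.lt_succ_iff.mp k.isLt)) ?_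
    · rw [Fin.strictMono_iff_lt_succ]
      intro k
      simpa using hθ k k.isLt
    · intro k
      simpa using hdist k k.isLt
  · intro H d v ε n θ p hθ hdom hdist
    let pN : ℕ → Equiv.Perm (Fin m) × (Fin m → Fin K) := fun k => if h : k < n + 1 then p ⟨k, h⟩ else p 0
    let θN : ℕ → ℤ := fun k => if h : k < n + 1 then θ ⟨k, h⟩ else 0
    have hpN : ∀ k (hk : k < n + 1), pN k = p ⟨k, hk⟩ := fun k hk => by simp only [pN, dif_pos hk]
    have hθN : ∀ k (hk : k < n + 1), θN k = θ ⟨k, hk⟩ := fun k hk => by simp only [θN, dif_pos hk]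
    refine H d n pN ?_ ?_
    · intro k hk
      rw [hpN k (by omega), hpN (k + 1) (by omega)]
      exact hdist ⟨k, hk⟩
    · intro lam hlam hsupp hbal hpre
      refine no_certificate_of_design d n pN v ε θN ?_ ?_ lam hlam hsupp hbal hpre
      · intro k hk
        rw [hθN k (by omega), hθN (k + 1) (by omega)]
        exact hθ (show (⟨k, by omega⟩ : Fin (n + 1)) < ⟨k + 1, by omega⟩ from Fin.mk_lt_mk.mpr (Nat.lt_succ_self k))
      · intro k hk
        rw [hpN k (by omega), hθN k (by omega)]
        exact hdom _

end Summit.ValiantsHypothesis.ValiantsHypothesis.Theorems.KPlusLogSqLaw.MasterLaw
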